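import Summits.ResolutionOfSingularities.ResolutionOfSingularities.Theorems.PurelyInseparableDim4PureLeafUnitEven
import Summits.ResolutionOfSingularities.ResolutionOfSingularities.Theorems.PurelyInseparableDim4PureLeafUnitPthPower
import Summits.ResolutionOfSingularities.ResolutionOfSingularities.Theorems.PurelyInseparableDim4PureLeafUnitLeafWin
import Summits.ResolutionOfSingularities.ResolutionOfSingularities.Theorems.PurelyInseparableDim4PureLeafUnitInScopeBookings
import Summits.ResolutionOfSingularities.ResolutionOfSingularities.Theorems.PurelyInseparableDim4PureLeafUnitInScope1133
import Summits.ResolutionOfSingularities.ResolutionOfSingularities.Theorems.PurelyInseparableDim4PureLeafUnitInScope1313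
import Summits.ResolutionOfSingularities.ResolutionOfSingularities.Theorems.PurelyInseparableDim4PureLeafUnitInScope1331
import Summits.ResolutionOfSingularities.ResolutionOfSingularities.Theorems.PurelyInseparableDim4PureLeafUnitInScope3123
import Summits.ResolutionOfSingularities.ResolutionOfSingularities.Theorems.PurelyInseparableDim4PureLeafUnitInScope3132
import Summits.ResolutionOfSingularities.ResolutionOfSingularities.Theorems.PurelyInseparableDim4PureLeafUnitInScope3213
import Summits.ResolutionOfSingularities.ResolutionOfSingularities.Theorems.PurelyInseparableDim4PureLeafUnitInScope3312
import Summits.ResolutionOfSingularities.ResolutionOfSingularities.Theorems.PurelyInseparableDim4PureLeafUnitInScope3231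
import Summits.ResolutionOfSingularities.ResolutionOfSingularities.Theorems.PurelyInseparableDim4PureLeafUnitInScope3321
import Summits.ResolutionOfSingularities.ResolutionOfSingularities.Theorems.PurelyInseparableDim4PureLeafUnitInScope3131
import Summits.ResolutionOfSingularities.ResolutionOfSingularities.Theorems.PurelyInseparableDim4PureLeafUnitInScope3113
import Summits.ResolutionOfSingularities.ResolutionOfSingularities.Theorems.PurelyInseparableDim4PureLeafUnitInScope3311
import Summits.ResolutionOfSingularities.ResolutionOfSingularities.Theorems.PurelyInseparableDim4PureLeafUnitInScope3233
import Summits.ResolutionOfSingularities.ResolutionOfSingularities.Theorems.PurelyInseparableDim4PureLeafUnitInScope3323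
import Summits.ResolutionOfSingularities.ResolutionOfSingularities.Theorems.PurelyInseparableDim4PureLeafUnitInScope3332
import Summits.ResolutionOfSingularities.ResolutionOfSingularities.Theorems.PurelyInseparableDim4PureLeafUnitInScope1333
import Summits.ResolutionOfSingularities.ResolutionOfSingularities.Theorems.PurelyInseparableDim4PureLeafUnitInScope3133
import Summits.ResolutionOfSingularities.ResolutionOfSingularities.Theorems.PurelyInseparableDim4PureLeafUnitInScope3313
import Summits.ResolutionOfSingularities.ResolutionOfSingularities.Theorems.PurelyInseparableDim4PureLeafUnitInScope3331
import Summits.ResolutionOfSingularities.ResolutionOfSingularities.Theorems.PurelyInseparableDim4PureLeafUnitInScope3333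
import Summits.ResolutionOfSingularities.ResolutionOfSingularities.Theorems.PurelyInseparableDim4PureLeafUnitInScopeOdd1A
import Summits.ResolutionOfSingularities.ResolutionOfSingularities.Theorems.PurelyInseparableDim4PureLeafUnitInScopeOdd1B
import Summits.ResolutionOfSingularities.ResolutionOfSingularities.Theorems.PurelyInseparableDim4PureLeafUnitInScopeOdd3A
import Summits.ResolutionOfSingularities.ResolutionOfSingularities.Theorems.PurelyInseparableDim4PureLeafUnitInScopeOdd3B
import Summits.ResolutionOfSingularities.ResolutionOfSingularities.Theorems.PurelyInseparableDim4PureLeafUnitInScopeOdd3C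
import HarnessLib
import HarnessLib.Audit.Tags

/-!
# Purely inseparable fourfolds — CAPSTONE of brick (δ): ALL 81 unit leaves `x^a(1+x₀)`, `a ∈ {1,2,3}⁴`, are IN-SCOPE ESCAPABLE over `𝔽₂` ‖ K
# (cell res-dim4-pi, D-0157 DOOR 2; CONFIGS (2,2) unit-leaf row, in-scope column) [OURS · counted 0 · census corollary]

Width seat `res-dim4-p-10` (g4).  One theorem for the whole unit census of the memo `pub/res-dim4/res-dim4-p-10/UNIT-CLASS-TEXT.md`:
for every exponent vector `a ∈ {1,2,3}⁴` and EVERY booking `(r, exc)`, player A wins the IN-SCOPE game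
(`InScopeWinCert.InScopeStateWins 2`: A moves only at states inside coordinate scope, a state outside scope is terminal and won)
from `⟨x^a·(1+x₀), r, exc⟩` over `𝔽₂` with `𝔽₂`-rational replies.  Sources, cited not restated:
* `a₀ = 2` (27 leaves): the PLAIN-game win `PureLeafNF.stateWins_unitLeaf_even` (p702830) and `inScopeStateWins_of_stateWins`;
* `a ∈ {1222, 3222}`: `PureLeafNF.stateWins_unitLeaf_odd_of_forall_even` (p703461, `PthPowerShift.stateWins_add_iff`);
* `a = 1111`: generation 3's plain-game certificate `UnitDivergence.unitLeafRow18` (`…PureLeafUnitLeafWin`);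
* the 23 leaves left undecided by the plain-game searches: the kernel certificates `…PureLeafUnitInScope<a>` (namespaces
  `UnitLeaf<a>`, `UnitLeaf<a>R`, `UnitLeaf<a>N`; checkers `iwinCertHBLF` p706889 / `iwinCertHBLFN` p715381);
* the other 28 leaves with `a₀` odd: `…PureLeafUnitInScopeOdd1A/1B/3A/3B/3C`.
The term-list form of the certificates is converted to the monomial form by `monomial_mul_one_add_X_eq_evalT` / `of_cert`.  Also the
hypothesis form `inScopeStateWins_unitLeaf_of_mem` (`∀ i, a i = 1 ∨ a i = 2 ∨ a i = 3`).

What this is NOT: not the PLAIN game (`StateWins 2` of the 52 leaves with `a₀` odd and another odd exponent is OPEN in the tree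
except `1111`; B's located defence there runs into the magic curve, OUT of scope — `…PureLeafUnitMagicBlind` p706625), not MODE 1h,
not `∀ K`.  Riders: `𝔽₂`-rational replies only; nothing here proves F4-C(2,2), `Terminates1h 2 2` or resolution of singularities in
dimension ≥ 4 / characteristic `p`; counted 0; AI kernel work, weaker than expert review. bears_on: LADDER-RESOLUTION:D157-DOOR2
(res-dim4-pi · brick (δ) · unit census, in-scope column). Supports stmt-ResolutionOfSingularities-16155 (helper).
-/

set_option linter.dupNamespace false

open MvPolynomial

noncomputable section

namespace Summit.ResolutionOfSingularities.ResolutionOfSingularities.Theorems.PIDim4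

namespace InScopeWinCert

open Literature.AlgebraicGeometry.Resolution
open StepKit

/-- `expo (v + e₀) = expo v + e₀`. [folklore] -/
theorem expo_add_single_zero (v : Fin 4 → ℕ) : expo (v + Pi.single 0 1) = expo v + Finsupp.single 0 1 := by
  ext i
  fin_cases i <;> simp [expo_apply]

/-- Term-list form of a unit leaf: `x^v · (1 + x₀) = x^v + x^w` with `w = v + e₀`. [folklore] -/
theorem monomial_mul_one_add_X_eq_evalT (v w : Fin 4 → ℕ) (hw : w = v + Pi.single 0 1) :
    (monomial (expo v) 1 * (1 + X 0) : MvPolynomial (Fin 4) (ZMod 2)) = evalT [(v, 1), (w, 1)] := by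
  subst hw
  rw [evalT_cons, evalT_cons, evalT_nil, add_zero, mul_add, mul_one, X, monomial_mul, one_mul, expo_add_single_zero]

/-- From a term-form certificate (every booking) to the monomial form. [folklore] -/
theorem of_cert {v w : Fin 4 → ℕ} (hw : w = v + Pi.single 0 1)
    (h : ∀ (r : Fin 4 →₀ ℕ) (exc : Finset (Fin 4)), InScopeStateWins 2 (⟨evalT [(v, 1), (w, 1)], r, exc⟩ : State (ZMod 2)))
    (r : Fin 4 →₀ ℕ) (exc : Finset (Fin 4)) :
    InScopeStateWins 2 (⟨monomial (expo v) 1 * (1 + X 0), r, exc⟩ : State (ZMod 2)) :=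
  FlatAbsorb.inScopeStateWins_congr (h r exc) _ (monomial_mul_one_add_X_eq_evalT v w hw)

/-- The 81 exponent vectors `{1,2,3}⁴` of the unit census, in lexicographic order. [folklore] -/
def unitCensus81 : List (Fin 4 → ℕ) := [
  ![1, 1, 1, 1], ![1, 1, 1, 2], ![1, 1, 1, 3], ![1, 1, 2, 1], ![1, 1, 2, 2], ![1, 1, 2, 3],
  ![1, 1, 3, 1], ![1, 1, 3, 2], ![1, 1, 3, 3], ![1, 2, 1, 1], ![1, 2, 1, 2], ![1, 2, 1, 3],
  ![1, 2, 2, 1], ![1, 2, 2, 2], ![1, 2, 2, 3], ![1, 2, 3, 1], ![1, 2, 3, 2], ![1, 2, 3, 3],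
  ![1, 3, 1, 1], ![1, 3, 1, 2], ![1, 3, 1, 3], ![1, 3, 2, 1], ![1, 3, 2, 2], ![1, 3, 2, 3],
  ![1, 3, 3, 1], ![1, 3, 3, 2], ![1, 3, 3, 3], ![2, 1, 1, 1], ![2, 1, 1, 2], ![2, 1, 1, 3],
  ![2, 1, 2, 1], ![2, 1, 2, 2], ![2, 1, 2, 3], ![2, 1, 3, 1], ![2, 1, 3, 2], ![2, 1, 3, 3],
  ![2, 2, 1, 1], ![2, 2, 1, 2], ![2, 2, 1, 3], ![2, 2, 2, 1], ![2, 2, 2, 2], ![2, 2, 2, 3],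
  ![2, 2, 3, 1], ![2, 2, 3, 2], ![2, 2, 3, 3], ![2, 3, 1, 1], ![2, 3, 1, 2], ![2, 3, 1, 3],
  ![2, 3, 2, 1], ![2, 3, 2, 2], ![2, 3, 2, 3], ![2, 3, 3, 1], ![2, 3, 3, 2], ![2, 3, 3, 3],
  ![3, 1, 1, 1], ![3, 1, 1, 2], ![3, 1, 1, 3], ![3, 1, 2, 1], ![3, 1, 2, 2], ![3, 1, 2, 3],
  ![3, 1, 3, 1], ![3, 1, 3, 2], ![3, 1, 3, 3], ![3, 2, 1, 1], ![3, 2, 1, 2], ![3, 2, 1, 3],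
  ![3, 2, 2, 1], ![3, 2, 2, 2], ![3, 2, 2, 3], ![3, 2, 3, 1], ![3, 2, 3, 2], ![3, 2, 3, 3],
  ![3, 3, 1, 1], ![3, 3, 1, 2], ![3, 3, 1, 3], ![3, 3, 2, 1], ![3, 3, 2, 2], ![3, 3, 2, 3],
  ![3, 3, 3, 1], ![3, 3, 3, 2], ![3, 3, 3, 3] ]

/-- **CAPSTONE: every unit leaf of the census is in-scope escapable over `𝔽₂`, every booking.** [OURS · counted 0 · ‖ K]
[folklore] -/
theorem inScopeStateWins_unitCensus : ∀ v ∈ unitCensus81, ∀ (r : Fin 4 →₀ ℕ) (exc : Finset (Fin 4)),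
    InScopeStateWins 2 (⟨monomial (expo v) 1 * (1 + X 0), r, exc⟩ : State (ZMod 2)) := by
  unfold unitCensus81
  refine List.forall_mem_cons.mpr ⟨fun r exc => ?_, ?_⟩ -- 1111
  · exact of_cert (by decide) (fun r exc => inScopeStateWins_of_stateWins (UnitDivergence.unitLeafRow18 r exc)) r exc
  refine List.forall_mem_cons.mpr ⟨fun r exc => ?_, ?_⟩ -- 1112
  · exact of_cert (by decide) UnitLeaf1112N.inScopeStateWins_unitLeaf_1112_all r exc
  refine List.forall_mem_cons.mpr ⟨fun r exc => ?_, ?_⟩ -- 1113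
  · exact of_cert (by decide) UnitLeaf1113.inScopeStateWins_unitLeaf_1113_all r exc
  refine List.forall_mem_cons.mpr ⟨fun r exc => ?_, ?_⟩ -- 1121
  · exact of_cert (by decide) UnitLeaf1121N.inScopeStateWins_unitLeaf_1121_all r exc
  refine List.forall_mem_cons.mpr ⟨fun r exc => ?_, ?_⟩ -- 1122
  · exact of_cert (by decide) UnitLeaf1122N.inScopeStateWins_unitLeaf_1122_all r exc
  refine List.forall_mem_cons.mpr ⟨fun r exc => ?_, ?_⟩ -- 1123
  · exact of_cert (by decide) UnitLeaf1123N.inScopeStateWins_unitLeaf_1123_all r exc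
  refine List.forall_mem_cons.mpr ⟨fun r exc => ?_, ?_⟩ -- 1131
  · exact of_cert (by decide) UnitLeaf1131.inScopeStateWins_unitLeaf_1131_all r exc
  refine List.forall_mem_cons.mpr ⟨fun r exc => ?_, ?_⟩ -- 1132
  · exact of_cert (by decide) UnitLeaf1132N.inScopeStateWins_unitLeaf_1132_all r exc
  refine List.forall_mem_cons.mpr ⟨fun r exc => ?_, ?_⟩ -- 1133
  · exact of_cert (by decide) UnitLeaf1133.inScopeStateWins_unitLeaf_1133_all r exc
  refine List.forall_mem_cons.mpr ⟨fun r exc => ?_, ?_⟩ -- 1211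
  · exact of_cert (by decide) UnitLeaf1211N.inScopeStateWins_unitLeaf_1211_all r exc
  refine List.forall_mem_cons.mpr ⟨fun r exc => ?_, ?_⟩ -- 1212
  · exact of_cert (by decide) UnitLeaf1212N.inScopeStateWins_unitLeaf_1212_all r exc
  refine List.forall_mem_cons.mpr ⟨fun r exc => ?_, ?_⟩ -- 1213
  · exact of_cert (by decide) UnitLeaf1213N.inScopeStateWins_unitLeaf_1213_all r exc
  refine List.forall_mem_cons.mpr ⟨fun r exc => ?_, ?_⟩ -- 1221
  · exact of_cert (by decide) UnitLeaf1221N.inScopeStateWins_unitLeaf_1221_all r exc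
  refine List.forall_mem_cons.mpr ⟨fun r exc => ?_, ?_⟩ -- 1222
  · exact inScopeStateWins_of_stateWins (PureLeafNF.stateWins_unitLeaf_odd_of_forall_even 0 _ (by decide) (by decide) r exc)
  refine List.forall_mem_cons.mpr ⟨fun r exc => ?_, ?_⟩ -- 1223
  · exact of_cert (by decide) UnitLeaf1223N.inScopeStateWins_unitLeaf_1223_all r exc
  refine List.forall_mem_cons.mpr ⟨fun r exc => ?_, ?_⟩ -- 1231
  · exact of_cert (by decide) UnitLeaf1231N.inScopeStateWins_unitLeaf_1231_all r exc
  refine List.forall_mem_cons.mpr ⟨fun r exc => ?_, ?_⟩ -- 1232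
  · exact of_cert (by decide) UnitLeaf1232N.inScopeStateWins_unitLeaf_1232_all r exc
  refine List.forall_mem_cons.mpr ⟨fun r exc => ?_, ?_⟩ -- 1233
  · exact of_cert (by decide) UnitLeaf1233N.inScopeStateWins_unitLeaf_1233_all r exc
  refine List.forall_mem_cons.mpr ⟨fun r exc => ?_, ?_⟩ -- 1311
  · exact of_cert (by decide) UnitLeaf1311.inScopeStateWins_unitLeaf_1311_all r exc
  refine List.forall_mem_cons.mpr ⟨fun r exc => ?_, ?_⟩ -- 1312
  · exact of_cert (by decide) UnitLeaf1312N.inScopeStateWins_unitLeaf_1312_all r exc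
  refine List.forall_mem_cons.mpr ⟨fun r exc => ?_, ?_⟩ -- 1313
  · exact of_cert (by decide) UnitLeaf1313.inScopeStateWins_unitLeaf_1313_all r exc
  refine List.forall_mem_cons.mpr ⟨fun r exc => ?_, ?_⟩ -- 1321
  · exact of_cert (by decide) UnitLeaf1321N.inScopeStateWins_unitLeaf_1321_all r exc
  refine List.forall_mem_cons.mpr ⟨fun r exc => ?_, ?_⟩ -- 1322
  · exact of_cert (by decide) UnitLeaf1322N.inScopeStateWins_unitLeaf_1322_all r exc
  refine List.forall_mem_cons.mpr ⟨fun r exc => ?_, ?_⟩ -- 1323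
  · exact of_cert (by decide) UnitLeaf1323N.inScopeStateWins_unitLeaf_1323_all r exc
  refine List.forall_mem_cons.mpr ⟨fun r exc => ?_, ?_⟩ -- 1331
  · exact of_cert (by decide) UnitLeaf1331.inScopeStateWins_unitLeaf_1331_all r exc
  refine List.forall_mem_cons.mpr ⟨fun r exc => ?_, ?_⟩ -- 1332
  · exact of_cert (by decide) UnitLeaf1332N.inScopeStateWins_unitLeaf_1332_all r exc
  refine List.forall_mem_cons.mpr ⟨fun r exc => ?_, ?_⟩ -- 1333
  · exact of_cert (by decide) UnitLeaf1333N.inScopeStateWins_unitLeaf_1333_all r exc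
  refine List.forall_mem_cons.mpr ⟨fun r exc => ?_, ?_⟩ -- 2111
  · exact inScopeStateWins_of_stateWins (PureLeafNF.stateWins_unitLeaf_even 0 ![2, 1, 1, 1] (by decide) r exc)
  refine List.forall_mem_cons.mpr ⟨fun r exc => ?_, ?_⟩ -- 2112
  · exact inScopeStateWins_of_stateWins (PureLeafNF.stateWins_unitLeaf_even 0 ![2, 1, 1, 2] (by decide) r exc)
  refine List.forall_mem_cons.mpr ⟨fun r exc => ?_, ?_⟩ -- 2113
  · exact inScopeStateWins_of_stateWins (PureLeafNF.stateWins_unitLeaf_even 0 ![2, 1, 1, 3] (by decide) r exc)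
  refine List.forall_mem_cons.mpr ⟨fun r exc => ?_, ?_⟩ -- 2121
  · exact inScopeStateWins_of_stateWins (PureLeafNF.stateWins_unitLeaf_even 0 ![2, 1, 2, 1] (by decide) r exc)
  refine List.forall_mem_cons.mpr ⟨fun r exc => ?_, ?_⟩ -- 2122
  · exact inScopeStateWins_of_stateWins (PureLeafNF.stateWins_unitLeaf_even 0 ![2, 1, 2, 2] (by decide) r exc)
  refine List.forall_mem_cons.mpr ⟨fun r exc => ?_, ?_⟩ -- 2123
  · exact inScopeStateWins_of_stateWins (PureLeafNF.stateWins_unitLeaf_even 0 ![2, 1, 2, 3] (by decide) r exc)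
  refine List.forall_mem_cons.mpr ⟨fun r exc => ?_, ?_⟩ -- 2131
  · exact inScopeStateWins_of_stateWins (PureLeafNF.stateWins_unitLeaf_even 0 ![2, 1, 3, 1] (by decide) r exc)
  refine List.forall_mem_cons.mpr ⟨fun r exc => ?_, ?_⟩ -- 2132
  · exact inScopeStateWins_of_stateWins (PureLeafNF.stateWins_unitLeaf_even 0 ![2, 1, 3, 2] (by decide) r exc)
  refine List.forall_mem_cons.mpr ⟨fun r exc => ?_, ?_⟩ -- 2133
  · exact inScopeStateWins_of_stateWins (PureLeafNF.stateWins_unitLeaf_even 0 ![2, 1, 3, 3] (by decide) r exc)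
  refine List.forall_mem_cons.mpr ⟨fun r exc => ?_, ?_⟩ -- 2211
  · exact inScopeStateWins_of_stateWins (PureLeafNF.stateWins_unitLeaf_even 0 ![2, 2, 1, 1] (by decide) r exc)
  refine List.forall_mem_cons.mpr ⟨fun r exc => ?_, ?_⟩ -- 2212
  · exact inScopeStateWins_of_stateWins (PureLeafNF.stateWins_unitLeaf_even 0 ![2, 2, 1, 2] (by decide) r exc)
  refine List.forall_mem_cons.mpr ⟨fun r exc => ?_, ?_⟩ -- 2213
  · exact inScopeStateWins_of_stateWins (PureLeafNF.stateWins_unitLeaf_even 0 ![2, 2, 1, 3] (by decide) r exc)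
  refine List.forall_mem_cons.mpr ⟨fun r exc => ?_, ?_⟩ -- 2221
  · exact inScopeStateWins_of_stateWins (PureLeafNF.stateWins_unitLeaf_even 0 ![2, 2, 2, 1] (by decide) r exc)
  refine List.forall_mem_cons.mpr ⟨fun r exc => ?_, ?_⟩ -- 2222
  · exact inScopeStateWins_of_stateWins (PureLeafNF.stateWins_unitLeaf_even 0 ![2, 2, 2, 2] (by decide) r exc)
  refine List.forall_mem_cons.mpr ⟨fun r exc => ?_, ?_⟩ -- 2223
  · exact inScopeStateWins_of_stateWins (PureLeafNF.stateWins_unitLeaf_even 0 ![2, 2, 2, 3] (by decide) r exc)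
  refine List.forall_mem_cons.mpr ⟨fun r exc => ?_, ?_⟩ -- 2231
  · exact inScopeStateWins_of_stateWins (PureLeafNF.stateWins_unitLeaf_even 0 ![2, 2, 3, 1] (by decide) r exc)
  refine List.forall_mem_cons.mpr ⟨fun r exc => ?_, ?_⟩ -- 2232
  · exact inScopeStateWins_of_stateWins (PureLeafNF.stateWins_unitLeaf_even 0 ![2, 2, 3, 2] (by decide) r exc)
  refine List.forall_mem_cons.mpr ⟨fun r exc => ?_, ?_⟩ -- 2233
  · exact inScopeStateWins_of_stateWins (PureLeafNF.stateWins_unitLeaf_even 0 ![2, 2, 3, 3] (by decide) r exc)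
  refine List.forall_mem_cons.mpr ⟨fun r exc => ?_, ?_⟩ -- 2311
  · exact inScopeStateWins_of_stateWins (PureLeafNF.stateWins_unitLeaf_even 0 ![2, 3, 1, 1] (by decide) r exc)
  refine List.forall_mem_cons.mpr ⟨fun r exc => ?_, ?_⟩ -- 2312
  · exact inScopeStateWins_of_stateWins (PureLeafNF.stateWins_unitLeaf_even 0 ![2, 3, 1, 2] (by decide) r exc)
  refine List.forall_mem_cons.mpr ⟨fun r exc => ?_, ?_⟩ -- 2313
  · exact inScopeStateWins_of_stateWins (PureLeafNF.stateWins_unitLeaf_even 0 ![2, 3, 1, 3] (by decide) r exc)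
  refine List.forall_mem_cons.mpr ⟨fun r exc => ?_, ?_⟩ -- 2321
  · exact inScopeStateWins_of_stateWins (PureLeafNF.stateWins_unitLeaf_even 0 ![2, 3, 2, 1] (by decide) r exc)
  refine List.forall_mem_cons.mpr ⟨fun r exc => ?_, ?_⟩ -- 2322
  · exact inScopeStateWins_of_stateWins (PureLeafNF.stateWins_unitLeaf_even 0 ![2, 3, 2, 2] (by decide) r exc)
  refine List.forall_mem_cons.mpr ⟨fun r exc => ?_, ?_⟩ -- 2323
  · exact inScopeStateWins_of_stateWins (PureLeafNF.stateWins_unitLeaf_even 0 ![2, 3, 2, 3] (by decide) r exc)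
  refine List.forall_mem_cons.mpr ⟨fun r exc => ?_, ?_⟩ -- 2331
  · exact inScopeStateWins_of_stateWins (PureLeafNF.stateWins_unitLeaf_even 0 ![2, 3, 3, 1] (by decide) r exc)
  refine List.forall_mem_cons.mpr ⟨fun r exc => ?_, ?_⟩ -- 2332
  · exact inScopeStateWins_of_stateWins (PureLeafNF.stateWins_unitLeaf_even 0 ![2, 3, 3, 2] (by decide) r exc)
  refine List.forall_mem_cons.mpr ⟨fun r exc => ?_, ?_⟩ -- 2333
  · exact inScopeStateWins_of_stateWins (PureLeafNF.stateWins_unitLeaf_even 0 ![2, 3, 3, 3] (by decide) r exc)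
  refine List.forall_mem_cons.mpr ⟨fun r exc => ?_, ?_⟩ -- 3111
  · exact of_cert (by decide) UnitLeaf3111N.inScopeStateWins_unitLeaf_3111_all r exc
  refine List.forall_mem_cons.mpr ⟨fun r exc => ?_, ?_⟩ -- 3112
  · exact of_cert (by decide) UnitLeaf3112N.inScopeStateWins_unitLeaf_3112_all r exc
  refine List.forall_mem_cons.mpr ⟨fun r exc => ?_, ?_⟩ -- 3113
  · exact of_cert (by decide) UnitLeaf3113.inScopeStateWins_unitLeaf_3113_all r exc
  refine List.forall_mem_cons.mpr ⟨fun r exc => ?_, ?_⟩ -- 3121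
  · exact of_cert (by decide) UnitLeaf3121N.inScopeStateWins_unitLeaf_3121_all r exc
  refine List.forall_mem_cons.mpr ⟨fun r exc => ?_, ?_⟩ -- 3122
  · exact of_cert (by decide) UnitLeaf3122N.inScopeStateWins_unitLeaf_3122_all r exc
  refine List.forall_mem_cons.mpr ⟨fun r exc => ?_, ?_⟩ -- 3123
  · exact of_cert (by decide) UnitLeaf3123.inScopeStateWins_unitLeaf_3123_all r exc
  refine List.forall_mem_cons.mpr ⟨fun r exc => ?_, ?_⟩ -- 3131
  · exact of_cert (by decide) UnitLeaf3131.inScopeStateWins_unitLeaf_3131_all r exc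
  refine List.forall_mem_cons.mpr ⟨fun r exc => ?_, ?_⟩ -- 3132
  · exact of_cert (by decide) UnitLeaf3132.inScopeStateWins_unitLeaf_3132_all r exc
  refine List.forall_mem_cons.mpr ⟨fun r exc => ?_, ?_⟩ -- 3133
  · exact of_cert (by decide) UnitLeaf3133N.inScopeStateWins_unitLeaf_3133_all r exc
  refine List.forall_mem_cons.mpr ⟨fun r exc => ?_, ?_⟩ -- 3211
  · exact of_cert (by decide) UnitLeaf3211N.inScopeStateWins_unitLeaf_3211_all r exc
  refine List.forall_mem_cons.mpr ⟨fun r exc => ?_, ?_⟩ -- 3212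
  · exact of_cert (by decide) UnitLeaf3212N.inScopeStateWins_unitLeaf_3212_all r exc
  refine List.forall_mem_cons.mpr ⟨fun r exc => ?_, ?_⟩ -- 3213
  · exact of_cert (by decide) UnitLeaf3213.inScopeStateWins_unitLeaf_3213_all r exc
  refine List.forall_mem_cons.mpr ⟨fun r exc => ?_, ?_⟩ -- 3221
  · exact of_cert (by decide) UnitLeaf3221N.inScopeStateWins_unitLeaf_3221_all r exc
  refine List.forall_mem_cons.mpr ⟨fun r exc => ?_, ?_⟩ -- 3222
  · exact inScopeStateWins_of_stateWins (PureLeafNF.stateWins_unitLeaf_odd_of_forall_even 0 _ (by decide) (by decide) r exc)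
  refine List.forall_mem_cons.mpr ⟨fun r exc => ?_, ?_⟩ -- 3223
  · exact of_cert (by decide) UnitLeaf3223N.inScopeStateWins_unitLeaf_3223_all r exc
  refine List.forall_mem_cons.mpr ⟨fun r exc => ?_, ?_⟩ -- 3231
  · exact of_cert (by decide) UnitLeaf3231.inScopeStateWins_unitLeaf_3231_all r exc
  refine List.forall_mem_cons.mpr ⟨fun r exc => ?_, ?_⟩ -- 3232
  · exact of_cert (by decide) UnitLeaf3232N.inScopeStateWins_unitLeaf_3232_all r exc
  refine List.forall_mem_cons.mpr ⟨fun r exc => ?_, ?_⟩ -- 3233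
  · exact of_cert (by decide) UnitLeaf3233R.inScopeStateWins_unitLeaf_3233_all r exc
  refine List.forall_mem_cons.mpr ⟨fun r exc => ?_, ?_⟩ -- 3311
  · exact of_cert (by decide) UnitLeaf3311.inScopeStateWins_unitLeaf_3311_all r exc
  refine List.forall_mem_cons.mpr ⟨fun r exc => ?_, ?_⟩ -- 3312
  · exact of_cert (by decide) UnitLeaf3312.inScopeStateWins_unitLeaf_3312_all r exc
  refine List.forall_mem_cons.mpr ⟨fun r exc => ?_, ?_⟩ -- 3313
  · exact of_cert (by decide) UnitLeaf3313N.inScopeStateWins_unitLeaf_3313_all r exc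
  refine List.forall_mem_cons.mpr ⟨fun r exc => ?_, ?_⟩ -- 3321
  · exact of_cert (by decide) UnitLeaf3321.inScopeStateWins_unitLeaf_3321_all r exc
  refine List.forall_mem_cons.mpr ⟨fun r exc => ?_, ?_⟩ -- 3322
  · exact of_cert (by decide) UnitLeaf3322N.inScopeStateWins_unitLeaf_3322_all r exc
  refine List.forall_mem_cons.mpr ⟨fun r exc => ?_, ?_⟩ -- 3323
  · exact of_cert (by decide) UnitLeaf3323R.inScopeStateWins_unitLeaf_3323_all r exc
  refine List.forall_mem_cons.mpr ⟨fun r exc => ?_, ?_⟩ -- 3331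
  · exact of_cert (by decide) UnitLeaf3331N.inScopeStateWins_unitLeaf_3331_all r exc
  refine List.forall_mem_cons.mpr ⟨fun r exc => ?_, ?_⟩ -- 3332
  · exact of_cert (by decide) UnitLeaf3332R.inScopeStateWins_unitLeaf_3332_all r exc
  refine List.forall_mem_cons.mpr ⟨fun r exc => ?_, ?_⟩ -- 3333
  · exact of_cert (by decide) UnitLeaf3333N.inScopeStateWins_unitLeaf_3333_all r exc
  exact fun _ h => absurd h List.not_mem_nil

/-- Hypothesis form: every `a : Fin 4 → ℕ` with values in `{1,2,3}`. [OURS · counted 0 · ‖ K] [folklore] -/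
theorem inScopeStateWins_unitLeaf_of_mem (v : Fin 4 → ℕ) (hv : ∀ i, v i = 1 ∨ v i = 2 ∨ v i = 3)
    (r : Fin 4 →₀ ℕ) (exc : Finset (Fin 4)) :
    InScopeStateWins 2 (⟨monomial (expo v) 1 * (1 + X 0), r, exc⟩ : State (ZMod 2)) := by
  have hv' : v = ![v 0, v 1, v 2, v 3] := by ext i; fin_cases i <;> rfl
  rw [hv']
  rcases hv 0 with h0 | h0 | h0 <;> rcases hv 1 with h1 | h1 | h1 <;> rcases hv 2 with h2 | h2 | h2 <;>
    rcases hv 3 with h3 | h3 | h3 <;> simp only [h0, h1, h2, h3] <;>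
    exact inScopeStateWins_unitCensus _ (by decide) r exc

end InScopeWinCert

end Summit.ResolutionOfSingularities.ResolutionOfSingularities.Theorems.PIDim4

end
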